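import Summits.RiemannHypothesis.RiemannHypothesis.Theorems.Splittings.NbLimitCoefficients
import Summits.RiemannHypothesis.RiemannHypothesis.Theorems.NymanBeurlingKappaZerothOrder
import HarnessLib

/-!
# Splittings / NB — census row V38 «LIMIT COEFFICIENTS» (file 2 of 3): (T38a, RH-FREE) every optimal Báez-Duarte
coefficient `c⋆_{N,j} = nbMinimiser N j` CONVERGES as `N → ∞`; (T38c) under RH the limit is `−μ(j+1)`; and PLATEAU
CONVERGENCE — a bounded-distance coefficient family tending to Möbius coordinatewise has vanishing mass off every `(0, δ]`

Cell rh-split, seat rh-split-nb-neg g13 (card `SPLIT-nb-neg.md` §19); continues `Splittings/NbLimitCoefficients.lean` (the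
locks) in the SAME namespace.  Contents:
* §6 `abs_nbMinimiser_sub_le` — the RATE `|c⋆_{M,j} − c⋆_{N,j}| ≤ 5·2^j √(2 (d_M² − d_N²))` (`j < M ≤ N`; pad `c⋆_M` with
  zeros and complete the square: `(pad c⋆_M − c⋆_N)·G_N(pad c⋆_M − c⋆_N) = d_M² − d_N²`), and
  `tendsto_nbMinimiser_apply` (T38a) — **for every `j`, `N ↦ c⋆_{N,j}` converges** (Cauchy, since `N ↦ d_N²` is
  non-increasing and bounded below) — RH-FREE: the limits `γ_j` EXIST unconditionally;
* §7 `tendsto_nbMinimiser_apply_of_rh` (T38c) — RH ⟹ `γ_j = −μ(j+1)` (Möbius lock + `d_N → 0`);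
* §8 `tendsto_integral_Ioi_sq_approx` — PLATEAU CONVERGENCE (RH-FREE): if `d_N²(v_N) ≤ B` eventually and `v_N(j) → −μ(j+1)`
  for EVERY `j`, then `∫_{(1/(M+1), ∞)} (χ − Σ_k v_N(k) ρ_{k+1})² → 0` for every `M` (cell constants
  `1 + D_{v_N}(m) → 1 − Σ_{d ≤ m} μ(d)⌊m/d⌋ = 0`, and `τ(v_N) → 0` because `τ²(1/δ − 1)/2 ≲ d² ≤ B` for every `δ`).
File 3 (`Splittings/NbLimitCoefficientsRigidity.lean`) turns these into RH ⟺ TAIL(K) for every `K`.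

No `def`s; standard axioms.  HONEST LABEL: «SPLITTING SEARCH over kernel-typed RH-EQUIVALENCES; a splitting A ∧ B ⟹ RH is
CONDITIONAL bookkeeping unless A and B are both proved; nothing here bears on the truth of RH.»
-/

set_option linter.dupNamespace false

noncomputable section

open MeasureTheory Set Finset Filter Topology
open scoped Matrix

namespace Summit.RiemannHypothesis.RiemannHypothesis.Theorems.Splittings.NbLimitCoefficients

open Literature.NumberTheory.LFunctions Literature.NumberTheory.LFunctions.BaezDuarteOnlyIf
open Summit.RiemannHypothesis.RiemannHypothesis.Theorems.NbTheory
open Summit.RiemannHypothesis.RiemannHypothesis.Theorems.NbTheory.GramPosDef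
open Summit.RiemannHypothesis.RiemannHypothesis.Theorems.NbTheory.Minimiser
open Summit.RiemannHypothesis.RiemannHypothesis.Theorems.NbTheory.Criterion
open Summit.RiemannHypothesis.RiemannHypothesis.Theorems.NbTheory.KappaZeroth
open ArithmeticFunction (moebius)

/-! ## §6 (T38a) The optimal coefficients converge -/

/-- **Rate (RH-FREE).**  `|c⋆_{M,j} − c⋆_{N,j}| ≤ 5·2^j·√(2 (d_M² − d_N²))` for `j < M ≤ N`: pad `c⋆_M` with zeros to length
`N`; completing the square, `(pad c⋆_M − c⋆_N)·G_N(pad c⋆_M − c⋆_N) = d_N²(pad c⋆_M) − d_N² = d_M² − d_N²`. -/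
theorem abs_nbMinimiser_sub_le {j M N : ℕ} (hjM : j < M) (hMN : M ≤ N) :
    |nbMinimiser M ⟨j, hjM⟩ - nbMinimiser N ⟨j, by omega⟩| ≤
      5 * 2 ^ j * Real.sqrt (2 * (nbDistSq M (nbMinimiser M) - nbDistSq N (nbMinimiser N))) := by
  set p : Fin N → ℝ := fun k ↦ if h : (k : ℕ) < M then nbMinimiser M ⟨k, h⟩ else 0 with hp
  have hQ : (p - nbMinimiser N) ⬝ᵥ (nbGramMatrix N *ᵥ (p - nbMinimiser N)) =
      nbDistSq M (nbMinimiser M) - nbDistSq N (nbMinimiser N) := by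
    rw [← nbDistSq_sub_nbDistSq_nbMinimiser p, hp, nbDistSq_pad _ hMN]
  have h := abs_apply_le_of_gram (p - nbMinimiser N) ⟨j, by omega⟩
  rw [hQ] at h
  simpa [hp, dif_pos hjM] using h

/-- **(T38a, RH-FREE) For every fixed `j`, the optimal coefficient `c⋆_{N,j} = nbMinimiser N j` converges as `N → ∞`.**
(`N ↦ d_N²` is non-increasing and bounded below, so by the rate lemma the sequence is Cauchy.)  The statement is indexed
by `N + (j+1)` so that `j < N + (j+1)` needs no hypothesis. -/
theorem tendsto_nbMinimiser_apply (j : ℕ) :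
    ∃ γ : ℝ, Tendsto (fun N : ℕ ↦ nbMinimiser (N + (j + 1)) ⟨j, by omega⟩) atTop (𝓝 γ) := by
  set D : ℕ → ℝ := fun N ↦ nbDistSq (N + (j + 1)) (nbMinimiser (N + (j + 1))) with hD
  have hDanti : Antitone D := fun a b hab ↦ antitone_nbDistSq_nbMinimiser (by omega : a + (j + 1) ≤ b + (j + 1))
  have hDbdd : BddBelow (Set.range D) := ⟨0, by rintro _ ⟨N, rfl⟩; exact (nbDistSq_pos _).le⟩
  set L := ⨅ N, D N with hL
  have hDL : Tendsto D atTop (𝓝 L) := tendsto_atTop_ciInf hDanti hDbdd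
  have hLle : ∀ N, L ≤ D N := fun N ↦ ciInf_le hDbdd N
  set b : ℕ → ℝ := fun N ↦ 2 * (5 * 2 ^ j * Real.sqrt (2 * (D N - L))) with hb
  have hb0 : Tendsto b atTop (𝓝 0) := by
    have h0 : Tendsto (fun N ↦ D N - L) atTop (𝓝 0) := by
      have := hDL.sub_const L
      rwa [sub_self] at this
    have h1 := ((h0.const_mul 2).sqrt.const_mul (5 * 2 ^ j)).const_mul 2
    rw [mul_zero, Real.sqrt_zero, mul_zero, mul_zero] at h1
    exact h1
  have hone : ∀ n N : ℕ, N ≤ n →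
      |nbMinimiser (N + (j + 1)) ⟨j, by omega⟩ - nbMinimiser (n + (j + 1)) ⟨j, by omega⟩| ≤
        5 * 2 ^ j * Real.sqrt (2 * (D N - L)) := by
    intro n N hNn
    refine (abs_nbMinimiser_sub_le (by omega) (by omega)).trans ?_
    gcongr
    exact hLle n
  have hdist : ∀ n m N : ℕ, N ≤ n → N ≤ m →
      dist (nbMinimiser (n + (j + 1)) ⟨j, by omega⟩) (nbMinimiser (m + (j + 1)) ⟨j, by omega⟩) ≤ b N := by
    intro n m N hn hm
    rw [Real.dist_eq]
    have h1 := hone n N hn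
    have h2 := hone m N hm
    have h3 := abs_sub_le (nbMinimiser (n + (j + 1)) ⟨j, by omega⟩) (nbMinimiser (N + (j + 1)) ⟨j, by omega⟩)
      (nbMinimiser (m + (j + 1)) ⟨j, by omega⟩)
    rw [abs_sub_comm] at h1
    simp only [hb]
    linarith
  exact cauchySeq_tendsto_of_complete (cauchySeq_of_le_tendsto_0 b hdist hb0)

/-! ## §7 (T38c) Under RH the limits are the Möbius values -/

/-- **(T38c) RH ⟹ `c⋆_{N,j} → −μ(j+1)` for every `j`** (the Möbius lock read on `c⋆_N`, and `d_N → 0` under RH by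
`riemannHypothesis_iff_tendsto_nbDistSq_nbMinimiser`). -/
theorem tendsto_nbMinimiser_apply_of_rh (hRH : RiemannHypothesis) (j : ℕ) :
    Tendsto (fun N : ℕ ↦ nbMinimiser (N + (j + 1)) ⟨j, by omega⟩) atTop (𝓝 (-(moebius (j + 1) : ℝ))) := by
  have hD : Tendsto (fun N ↦ nbDistSq (N + (j + 1)) (nbMinimiser (N + (j + 1)))) atTop (𝓝 0) :=
    (riemannHypothesis_iff_tendsto_nbDistSq_nbMinimiser.1 hRH).comp (tendsto_add_atTop_nat (j + 1))
  have hg : Tendsto (fun N ↦ 5 * 2 ^ j * Real.sqrt (2 * nbDistSq (N + (j + 1)) (nbMinimiser (N + (j + 1)))))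
      atTop (𝓝 0) := by
    have h1 := (hD.const_mul 2).sqrt.const_mul (5 * 2 ^ j)
    simpa [Real.sqrt_zero] using h1
  refine tendsto_sub_nhds_zero_iff.1 (squeeze_zero_norm (fun N ↦ ?_) hg)
  rw [Real.norm_eq_abs, sub_neg_eq_add]
  exact abs_add_moebius_le (nbMinimiser (N + (j + 1))) ⟨j, by omega⟩

/-! ## §8 Plateau convergence: a coefficient family tending to Möbius has vanishing mass off every `(0, δ]` -/

/-- Shifted-index convergence `N ↦ v_{N+j+1}(j)` gives convergence of the zero-extended coordinate `N ↦ v_N(j)`. -/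
theorem tendsto_dite_of_tendsto_shift (v : (N : ℕ) → (Fin N → ℝ)) (j : ℕ) {L : ℝ}
    (h : Tendsto (fun N : ℕ ↦ v (N + (j + 1)) ⟨j, by omega⟩) atTop (𝓝 L)) :
    Tendsto (fun N : ℕ ↦ if hj : j < N then v N ⟨j, hj⟩ else 0) atTop (𝓝 L) := by
  rw [← tendsto_add_atTop_iff_nat (j + 1)]
  refine h.congr' (Eventually.of_forall fun N ↦ ?_)
  simp only [dif_pos (show j < N + (j + 1) by omega)]

/-- `(χ − Σ c_k ρ_{k+1})·ρ_{k+1}` is integrable on `(0,∞)`. -/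
theorem integrableOn_approx_mul_nbRho {N : ℕ} (c : Fin N → ℝ) (k : ℕ) :
    IntegrableOn (fun x ↦ approx c x * nbRho k x) (Set.Ioi (0 : ℝ)) := by
  have hpt : ∀ x, approx c x * nbRho k x =
      (Set.Ioc (0 : ℝ) 1).indicator 1 x * nbRho k x - ∑ j : Fin N, c j * (nbRho j x * nbRho k x) := by
    intro x
    rw [approx_eq, sub_mul, Finset.sum_mul]
    refine congrArg _ (Finset.sum_congr rfl fun j _ ↦ by ring)
  simp_rw [hpt]
  exact (integrableOn_indicator_mul_nbRho k).sub
    (integrable_finsetSum _ fun j _ ↦ (integrableOn_nbRho_mul_nbRho_Ioi_zero j k).const_mul _)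

/-- **PLATEAU CONVERGENCE (RH-FREE).**  Let `v_N : Fin N → ℝ` be coefficient vectors with `d_N²(v_N)` eventually bounded and
EVERY coordinate tending to the Möbius value, `v_N(j) → −μ(j+1)`.  Then for every `M` the mass of `χ − Σ v_N(k) ρ_{k+1}`
on `(1/(M+1), ∞)` tends to `0`: on that set the function is `(1 + D_{v_N}(m)) − τ(v_N)/x` cell by cell with
`1 + D_{v_N}(m) → 1 − Σ_{d≤m} μ(d)⌊m/d⌋ = 0`, and `τ(v_N) → 0` because `∫_{(δ,1]} τ²/(2x²) = τ²(1/δ − 1)/2` stays below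
`d² ≤ B`. -/
theorem tendsto_integral_Ioi_sq_approx (v : (N : ℕ) → (Fin N → ℝ)) {B : ℝ}
    (hB : ∀ᶠ N in atTop, nbDistSq N (v N) ≤ B)
    (hv : ∀ j : ℕ, Tendsto (fun N : ℕ ↦ if hj : j < N then v N ⟨j, hj⟩ else 0) atTop
      (𝓝 (-(moebius (j + 1) : ℝ)))) (M : ℕ) :
    Tendsto (fun N ↦ ∫ x in Set.Ioi (1 / ((M : ℝ) + 1)), approx (v N) x ^ 2) atTop (𝓝 0) := by
  -- (1) the cell constants converge: `D_{v_N}(n+1) → −1`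
  have hD : ∀ n : ℕ, Tendsto (fun N ↦ ∑ k : Fin N, v N k * (((n + 1) / ((k : ℕ) + 1) : ℕ) : ℝ)) atTop (𝓝 (-1)) := by
    intro n
    have hlim : Tendsto (fun N ↦ ∑ i ∈ range (n + 1),
        (if hi : i < N then v N ⟨i, hi⟩ else 0) * (((n + 1) / (i + 1) : ℕ) : ℝ)) atTop
        (𝓝 (∑ i ∈ range (n + 1), (-(moebius (i + 1) : ℝ)) * (((n + 1) / (i + 1) : ℕ) : ℝ))) :=
      tendsto_finsetSum _ fun i _ ↦ (hv i).mul_const _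
    have hval : ∑ i ∈ range (n + 1), (-(moebius (i + 1) : ℝ)) * (((n + 1) / (i + 1) : ℕ) : ℝ) = -1 := by
      have h := sum_moebius_mul_floor (N := n + 1) (m := n) (by omega)
      rw [Fin.sum_univ_eq_sum_range (fun i ↦ (moebius (i + 1) : ℝ) * (((n + 1) / (i + 1) : ℕ) : ℝ)) (n + 1)] at h
      simp only [neg_mul, Finset.sum_neg_distrib, h]
    rw [hval] at hlim
    refine hlim.congr' ?_
    filter_upwards [eventually_ge_atTop (n + 1)] with N hN
    have hL := Fin.sum_univ_eq_sum_range
      (fun i ↦ (if hi : i < N then v N ⟨i, hi⟩ else 0) * (((n + 1) / (i + 1) : ℕ) : ℝ)) N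
    have hL' : ∑ k : Fin N, v N k * (((n + 1) / ((k : ℕ) + 1) : ℕ) : ℝ) =
        ∑ i ∈ range N, (if hi : i < N then v N ⟨i, hi⟩ else 0) * (((n + 1) / (i + 1) : ℕ) : ℝ) := by
      rw [← hL]
      refine Finset.sum_congr rfl fun k _ ↦ ?_
      rw [dif_pos k.isLt]
    rw [hL']
    refine Finset.sum_subset (Finset.range_mono hN) fun i _ hi ↦ ?_
    rw [Finset.mem_range, not_lt] at hi
    rw [Nat.div_eq_of_lt (by omega), Nat.cast_zero, mul_zero]
  -- (2) `η_{M'}(N) = Σ_{n<M'} |1 + D_{v_N}(n+1)| → 0`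
  set η : ℕ → ℕ → ℝ := fun M' N ↦
    ∑ n ∈ range M', |1 + ∑ k : Fin N, v N k * (((n + 1) / ((k : ℕ) + 1) : ℕ) : ℝ)| with hηdef
  have hη0 : ∀ M', Tendsto (η M') atTop (𝓝 0) := by
    intro M'
    have h := tendsto_finsetSum (range M') fun n _ ↦ ((hD n).const_add 1).abs
    simp only [add_neg_cancel, abs_zero, Finset.sum_const_zero] at h
    exact h
  have hηnn : ∀ M' N, 0 ≤ η M' N := fun M' N ↦ Finset.sum_nonneg fun n _ ↦ abs_nonneg _
  -- (3) pointwise structure on `(1/(M'+1), 1]`: `approx = a − τ/x` with `|a| ≤ η`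
  have hPW : ∀ M' N : ℕ, ∀ x ∈ Set.Ioc (1 / ((M' : ℝ) + 1)) 1, |approx (v N) x + tailConst (v N) / x| ≤ η M' N := by
    intro M' N x hx
    have hδ : 0 < 1 / ((M' : ℝ) + 1) := by positivity
    have hx0 : 0 < x := hδ.trans hx.1
    have hx01 : x ∈ Set.Ioc (0 : ℝ) 1 := ⟨hx0, hx.2⟩
    have hcell := mem_nbI_of_mem_Ioc hx01
    set n := ⌊1 / x⌋₊ - 1 with hn
    have hfl := floor_eq_of_mem_nbI hcell
    have hnM : n < M' := by
      have h1 : 1 / x < (M' : ℝ) + 1 := (one_div_lt hx0 (by positivity)).2 hx.1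
      have h2 : ⌊1 / x⌋₊ < M' + 1 := (Nat.floor_lt (by positivity)).2 (by exact_mod_cast h1)
      omega
    have happ : approx (v N) x + tailConst (v N) / x =
        1 + ∑ k : Fin N, v N k * (((n + 1) / ((k : ℕ) + 1) : ℕ) : ℝ) := by
      rw [approx_eq_of_mem_Ioc (v N) hx01, sum_mul_nbRho_eq_of_mem_nbI (v N) hcell]
      ring
    rw [happ]
    exact Finset.single_le_sum (f := fun m ↦ |1 + ∑ k : Fin N, v N k * (((m + 1) / ((k : ℕ) + 1) : ℕ) : ℝ)|)
      (fun i _ ↦ abs_nonneg _) (Finset.mem_range.2 hnM)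
  -- (4) UPPER bound on `(1/(M'+1), 1]`
  have hUB : ∀ M' N : ℕ, ∫ x in Set.Ioc (1 / ((M' : ℝ) + 1)) 1, approx (v N) x ^ 2 ≤
      2 * η M' N ^ 2 + 2 * tailConst (v N) ^ 2 * ((M' : ℝ) + 1) ^ 2 := by
    intro M' N
    have hδ : 0 < 1 / ((M' : ℝ) + 1) := by positivity
    have hC : 0 ≤ 2 * η M' N ^ 2 + 2 * tailConst (v N) ^ 2 * ((M' : ℝ) + 1) ^ 2 := by positivity
    have hpt : ∀ x ∈ Set.Ioc (1 / ((M' : ℝ) + 1)) 1,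
        ‖approx (v N) x ^ 2‖ ≤ 2 * η M' N ^ 2 + 2 * tailConst (v N) ^ 2 * ((M' : ℝ) + 1) ^ 2 := by
      intro x hx
      have hx0 : 0 < x := hδ.trans hx.1
      have ha := hPW M' N x hx
      have hinv : 1 / x < (M' : ℝ) + 1 := (one_div_lt hx0 (by positivity)).2 hx.1
      have hinv0 : 0 < 1 / x := by positivity
      have h1 : (tailConst (v N) / x) ^ 2 ≤ tailConst (v N) ^ 2 * ((M' : ℝ) + 1) ^ 2 := by
        rw [div_eq_mul_one_div, mul_pow]
        exact mul_le_mul_of_nonneg_left (pow_le_pow_left₀ hinv0.le hinv.le 2) (sq_nonneg _)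
      have h2 : (approx (v N) x + tailConst (v N) / x) ^ 2 ≤ η M' N ^ 2 :=
        sq_le_sq' (abs_le.1 ha).1 (abs_le.1 ha).2
      rw [Real.norm_eq_abs, abs_of_nonneg (sq_nonneg _)]
      nlinarith [sq_nonneg (approx (v N) x + tailConst (v N) / x + tailConst (v N) / x)]
    have h := norm_setIntegral_le_of_norm_le_const
      (measure_Ioc_lt_top : volume (Set.Ioc (1 / ((M' : ℝ) + 1)) 1) < ⊤) hpt
    have hvol : volume.real (Set.Ioc (1 / ((M' : ℝ) + 1)) 1) ≤ 1 := by
      have hδ1 : 1 / ((M' : ℝ) + 1) ≤ 1 := by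
        rw [div_le_one (by positivity)]; linarith [(Nat.cast_nonneg M' : (0 : ℝ) ≤ M')]
      rw [measureReal_def, Real.volume_Ioc, ENNReal.toReal_ofReal (by linarith)]
      linarith
    rw [Real.norm_eq_abs] at h
    calc ∫ x in Set.Ioc (1 / ((M' : ℝ) + 1)) 1, approx (v N) x ^ 2
        ≤ |∫ x in Set.Ioc (1 / ((M' : ℝ) + 1)) 1, approx (v N) x ^ 2| := le_abs_self _
      _ ≤ _ := h
      _ ≤ (2 * η M' N ^ 2 + 2 * tailConst (v N) ^ 2 * ((M' : ℝ) + 1) ^ 2) * 1 :=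
          mul_le_mul_of_nonneg_left hvol hC
      _ = _ := mul_one _
  -- (5) LOWER bound on `(1/(M'+1), 1]`: `τ² M'/2 − η² ≤ d² − τ²`
  have hLB : ∀ M' N : ℕ, tailConst (v N) ^ 2 * (M' : ℝ) / 2 - η M' N ^ 2 ≤ nbDistSq N (v N) - tailConst (v N) ^ 2 := by
    intro M' N
    set δ : ℝ := 1 / ((M' : ℝ) + 1) with hδdef
    have hδ : 0 < δ := by positivity
    have hδ1 : δ ≤ 1 := by
      rw [hδdef, div_le_one (by positivity)]; linarith [(Nat.cast_nonneg M' : (0 : ℝ) ≤ M')]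
    have hδinv : δ⁻¹ = (M' : ℝ) + 1 := by rw [hδdef, one_div, inv_inv]
    set T := tailConst (v N) with hTdef
    have hhead : ∫ x in Set.Ioc (0 : ℝ) 1, approx (v N) x ^ 2 = nbDistSq N (v N) - T ^ 2 := by
      rw [setIntegral_congr_fun measurableSet_Ioc (fun x hx ↦ by rw [approx_eq_of_mem_Ioc (v N) hx]),
        nbDistSq_eq_head_add_tail]
      ring
    have hmono : ∫ x in Set.Ioc δ 1, approx (v N) x ^ 2 ≤ ∫ x in Set.Ioc (0 : ℝ) 1, approx (v N) x ^ 2 :=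
      setIntegral_mono_set ((integrableOn_sq_approx (v N)).mono_set Set.Ioc_subset_Ioi_self)
        (ae_of_all _ fun x ↦ sq_nonneg _) (ae_of_all _ (Set.Ioc_subset_Ioc_left hδ.le))
    -- the minorant `T²/2 · x⁻² − η²`
    have hcont : ContinuousOn (fun x : ℝ ↦ (x ^ 2)⁻¹) (Set.Icc δ 1) :=
      (continuousOn_pow 2).inv₀ fun x hx ↦ pow_ne_zero 2 (hδ.trans_le hx.1).ne'
    have hgint : IntegrableOn (fun x : ℝ ↦ T ^ 2 / 2 * (x ^ 2)⁻¹ - η M' N ^ 2) (Set.Ioc δ 1) :=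
      (((hcont.integrableOn_Icc).mono_set Set.Ioc_subset_Icc_self).const_mul _).sub
        (integrableOn_const (hs := measure_Ioc_lt_top.ne))
    have hpt : ∀ x ∈ Set.Ioc δ 1, T ^ 2 / 2 * (x ^ 2)⁻¹ - η M' N ^ 2 ≤ approx (v N) x ^ 2 := by
      intro x hx
      have hx0 : 0 < x := hδ.trans hx.1
      have ha := hPW M' N x hx
      have h2 : (approx (v N) x + T / x) ^ 2 ≤ η M' N ^ 2 := sq_le_sq' (abs_le.1 ha).1 (abs_le.1 ha).2
      have h3 : (T / x) ^ 2 = T ^ 2 * (x ^ 2)⁻¹ := by rw [div_pow, div_eq_mul_inv]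
      nlinarith [sq_nonneg (approx (v N) x + T / x + approx (v N) x)]
    have hinvint : ∫ x in Set.Ioc δ 1, (x ^ 2)⁻¹ = δ⁻¹ - 1 := by
      rw [← intervalIntegral.integral_of_le hδ1]
      have hderiv : ∀ x ∈ Set.uIcc δ 1, HasDerivAt (fun y : ℝ ↦ -y⁻¹) ((x ^ 2)⁻¹) x := by
        intro x hx
        rw [Set.uIcc_of_le hδ1] at hx
        have hx0 : x ≠ 0 := (hδ.trans_le hx.1).ne'
        have h : HasDerivAt (fun y : ℝ ↦ -y⁻¹) (-(-(x ^ 2)⁻¹)) x := (hasDerivAt_inv hx0).neg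
        rwa [neg_neg] at h
      have hcont' : ContinuousOn (fun x : ℝ ↦ (x ^ 2)⁻¹) (Set.uIcc δ 1) := by rwa [Set.uIcc_of_le hδ1]
      rw [intervalIntegral.integral_eq_sub_of_hasDerivAt hderiv hcont'.intervalIntegrable]
      show -(1 : ℝ)⁻¹ - -δ⁻¹ = δ⁻¹ - 1
      rw [inv_one]
      ring
    have hgval : ∫ x in Set.Ioc δ 1, (T ^ 2 / 2 * (x ^ 2)⁻¹ - η M' N ^ 2) =
        T ^ 2 / 2 * (δ⁻¹ - 1) - η M' N ^ 2 * (1 - δ) := by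
      rw [integral_sub (((hcont.integrableOn_Icc).mono_set Set.Ioc_subset_Icc_self).const_mul _)
        (integrableOn_const (hs := measure_Ioc_lt_top.ne)), integral_const_mul, hinvint, setIntegral_const,
        smul_eq_mul, measureReal_def, Real.volume_Ioc, ENNReal.toReal_ofReal (by linarith)]
      ring
    have hcmp := setIntegral_mono_on hgint ((integrableOn_sq_approx (v N)).mono_set
      (Set.Ioc_subset_Ioi_self.trans (Set.Ioi_subset_Ioi hδ.le))) measurableSet_Ioc hpt
    rw [hgval, hδinv] at hcmp
    have hη2 : 0 ≤ η M' N ^ 2 * δ := by positivity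
    nlinarith [hcmp, hmono, hhead, hη2]
  -- (6) `τ(v_N) → 0`
  have hT : Tendsto (fun N ↦ tailConst (v N)) atTop (𝓝 0) := by
    rw [Metric.tendsto_atTop]
    intro ε hε
    obtain ⟨M', hM'⟩ := exists_nat_gt (2 * (|B| + 1) / ε ^ 2)
    have hev : ∀ᶠ N in atTop, η M' N < 1 ∧ nbDistSq N (v N) ≤ B :=
      ((hη0 M').eventually (Iio_mem_nhds one_pos)).and hB
    obtain ⟨N₀, hN₀⟩ := eventually_atTop.1 hev
    refine ⟨N₀, fun N hN ↦ ?_⟩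
    obtain ⟨hη1, hBN⟩ := hN₀ N hN
    rw [Real.dist_eq, sub_zero]
    have hlb := hLB M' N
    have hηsq : η M' N ^ 2 ≤ 1 := by nlinarith [hηnn M' N]
    have hε2 : 0 < ε ^ 2 := by positivity
    have hM'' : 2 * (|B| + 1) < ε ^ 2 * M' := by
      have := (div_lt_iff₀ hε2).1 hM'; linarith
    have hBabs : B ≤ |B| := le_abs_self B
    have h1 : tailConst (v N) ^ 2 * ((M' : ℝ) + 2) ≤ 2 * (B + 1) := by linarith
    have h2 : tailConst (v N) ^ 2 * ((M' : ℝ) + 2) < ε ^ 2 * ((M' : ℝ) + 2) := by linarith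
    exact abs_lt_of_sq_lt_sq (lt_of_mul_lt_mul_right h2 (by positivity)) hε.le
  -- (7) conclusion: `∫_{(δ_M, ∞)} = ∫_{(δ_M, 1]} + τ² ≤ 2η² + (2(M+1)² + 1)τ² → 0`
  have hδ : 0 < 1 / ((M : ℝ) + 1) := by positivity
  have hδ1 : 1 / ((M : ℝ) + 1) ≤ 1 := by
    rw [div_le_one (by positivity)]; linarith [(Nat.cast_nonneg M : (0 : ℝ) ≤ M)]
  have hsplit : ∀ N, ∫ x in Set.Ioi (1 / ((M : ℝ) + 1)), approx (v N) x ^ 2 =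
      (∫ x in Set.Ioc (1 / ((M : ℝ) + 1)) 1, approx (v N) x ^ 2) + tailConst (v N) ^ 2 := by
    intro N
    have hint := integrableOn_sq_approx (v N)
    rw [← Set.Ioc_union_Ioi_eq_Ioi hδ1, setIntegral_union Set.Ioc_disjoint_Ioi_same measurableSet_Ioi
      (hint.mono_set (Set.Ioc_subset_Ioi_self.trans (Set.Ioi_subset_Ioi hδ.le)))
      (hint.mono_set (Set.Ioi_subset_Ioi zero_le_one)), integral_Ioi_one_sq_approx]
  have hg : Tendsto (fun N ↦ 2 * η M N ^ 2 + (2 * ((M : ℝ) + 1) ^ 2 + 1) * tailConst (v N) ^ 2) atTop (𝓝 0) := by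
    have h := (((hη0 M).pow 2).const_mul 2).add ((hT.pow 2).const_mul (2 * ((M : ℝ) + 1) ^ 2 + 1))
    simpa using h
  refine squeeze_zero (fun N ↦ integral_nonneg fun x ↦ sq_nonneg _) (fun N ↦ ?_) hg
  rw [hsplit N]
  have := hUB M N
  linarith

end Summit.RiemannHypothesis.RiemannHypothesis.Theorems.Splittings.NbLimitCoefficients

end
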